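import Literature.AlgebraicGeometry.HodgeTheory.FermatConeSpanOfConeDatum
import Literature.AlgebraicGeometry.HodgeTheory.ComplexOrientationDegreeOne
import Literature.AlgebraicGeometry.HodgeTheory.FermatAokiCycleClassEigenSupport
import HarnessLib

/-!
# The cone-span leaf (III-l) from an INCIDENCE datum: no automorphisms of the total space are needed

Family `hodge`, layer `Literature/AlgebraicGeometry/HodgeTheory`. PROOF FILE (theorems only; no
definition, no named fact). Sequel of `FermatConeSpanOfConeDatum` (N. Aoki, J. Math. Soc. Japan 39
(1987), Thm. 1-4 (i) with `r = 0`; Z. Ran, Compositio Math. 42 (1980), Prop. 1.14; T. Shioda, Math. Ann.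
245 (1979), Thm. I: the completed cones over `S = X²ˢₘ = {x₀ = x₁ = 0} ⊂ X = X^{2(0+s+1)}ₘ` represent
`(c,-c) ∗ β`). There the cone datum carried, besides the span `S ←π— E —φ→ X` with its base section
`σ`, a family (stab) of AUTOMORPHISMS of `E` covering the diagonal symmetries `g_a`, `a₀ = a₁`, used to
make `x = φ_* π^* w` an eigenvector of the stabiliser. THIS FILE removes (stab): replace `x` by its
stabiliser average `x̄ = N⁻¹ Σ_{a₀ = a₁} χ_{0∗β}(a)⁻¹ g_a^* x`, which is an eigenvector for free and has the
SAME `(α∗β)`-component (`χ_{α∗β} = χ_{0∗β}` on the stabiliser), and compute `φ^*(g_b^* x̄)` off the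
stabiliser by the general clean base change (`complexGysin_cleanBaseChange_of_ne_zero`, Fulton Thm. 6.2 (a))
for the squares `S —σ→ E —(φ ≫ g_c)→ X ←φ— E ←(g_{c|S} ≫ σ)— S`: the moved cone `g_c(φ(E))` meets `φ(E)`
exactly along the base, the two parametrisations of the base differing by `g_{c|S}`. The geometric
input shrinks to the INCIDENCE DATUM

* (inc') for every `c ∈ μₘ^{2s+4}` with `c₀ ≠ c₁`: `g_c(φ P) = φ Q` only if `P = σ R`, `Q = σ(g_{c|S} R)`;
* (h1) `φ^*(φ_* 1) ≠ 0`,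

on a span of smooth projective varieties with `π` flat and `σ` a closed-immersion section — for the
printed `E = ℙ(O ⊕ O(1))` (the cone blown up at its vertex) both are statements about points and the
hyperplane class.

* `fermatCharacter_append_eq_of_apply_eq` — `χ_{α∗β}(a) = χ_{0∗β}(a)` when `a₀ = a₁` (`α₀ + α₁ = 0`);
* `coneSpan_represents_of_incidenceDatum` — **the conclusion of (III-l) for `(m, s)` from an incidence
  datum**;
* `Shioda1979_coneSpan_represents_left_of_incidenceData` — **(III-l) from incidence data for all
  `m, s ≥ 1`**.

## References

* [Aoki1987] N. Aoki, Some new algebraic cycles on Fermat varieties, J. Math. Soc. Japan 39 (1987)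
  385–396: Thm. 1-4 (i) p. 388, p. 386.
* [Shioda1979HodgeFermat] T. Shioda, The Hodge conjecture for Fermat varieties, Math. Ann. 245 (1979)
  175–184, §1 and Thm. I.
* [Ran1980] Z. Ran, Cycles on Fermat hypersurfaces, Compositio Math. 42 (1980), §1 Prop. 1.14.
* [daSilva2021HodgeFermat] G. da Silva Jr., arXiv:2101.04739, Thm. 2.2 (b).
* [Fulton1998] W. Fulton, Intersection Theory, 2nd ed. 1998, Thm. 6.2 (a), §19.2.
* [SerreLinearRepresentations1977] J.-P. Serre, Linear Representations of Finite Groups, §2.6 Thm. 8.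
-/

noncomputable section

open CategoryTheory CategoryTheory.Limits AlgebraicGeometry Finset MonoidalCategory CartesianMonoidalCategory
open Literature.AlgebraicGeometry.Motives Literature.AlgebraicTopology.SingularHomology

namespace Literature.AlgebraicGeometry.HodgeTheory

open FermatCharacter (append embFirst embSecond)

variable {m s : ℕ}

/-- **`χ_{α∗β}(a) = χ_{0∗β}(a)` on the stabiliser `a₀ = a₁`** (`α = (c, -c)` admissible): the vertex
factor is `a₀^{⟨c⟩} a₁^{⟨-c⟩} = a₀^{m} = 1`. [cite: Shioda1979PJA, §4]
[cite: SerreLinearRepresentations1977, §2.6 Thm. 8] -/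
theorem fermatCharacter_append_eq_of_apply_eq [NeZero m] {α : Fin (2 * 0 + 2) → ZMod m}
    (hα : FermatCharacter.IsAdmissible α) (β : Fin (2 * s + 2) → ZMod m)
    (a : fermatGroup (2 * (0 + s + 1)) m)
    (ha : (a : Fin (2 * (0 + s + 1) + 2) → ℂˣ) (embFirst 0 s 0) =
      (a : Fin (2 * (0 + s + 1) + 2) → ℂˣ) (embFirst 0 s 1)) :
    fermatCharacter m (append α β) a = fermatCharacter m (append (0 : Fin (2 * 0 + 2) → ZMod m) β) a := by
  rw [fermatCharacter_append_zero, fermatCharacter_apply, fermatCharacter_apply]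
  change ∏ j, (a : Fin (2 * (0 + s + 1) + 2) → ℂˣ) j ^ (append α β j).val =
    ∏ k, (a : Fin (2 * (0 + s + 1) + 2) → ℂˣ) (embSecond 0 s k) ^ (β k).val
  rw [← Fintype.prod_equiv (finCongr (FermatCharacter.two_mul_add_two 0 s)).symm
    (fun j' ↦ (a : Fin (2 * (0 + s + 1) + 2) → ℂˣ) ((finCongr (FermatCharacter.two_mul_add_two 0 s)).symm j') ^
      (append α β ((finCongr (FermatCharacter.two_mul_add_two 0 s)).symm j')).val)
    _ (fun _ ↦ rfl), Fin.prod_univ_add]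
  have h1 : ∏ i : Fin (2 * 0 + 2), (a : Fin (2 * (0 + s + 1) + 2) → ℂˣ)
      ((finCongr (FermatCharacter.two_mul_add_two 0 s)).symm (Fin.castAdd (2 * s + 2) i)) ^
        (append α β ((finCongr (FermatCharacter.two_mul_add_two 0 s)).symm (Fin.castAdd (2 * s + 2) i))).val = 1 := by
    rw [Fin.prod_univ_two]
    change (a : Fin (2 * (0 + s + 1) + 2) → ℂˣ) (embFirst 0 s 0) ^ (append α β (embFirst 0 s 0)).val *
      (a : Fin (2 * (0 + s + 1) + 2) → ℂˣ) (embFirst 0 s 1) ^ (append α β (embFirst 0 s 1)).val = 1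
    rw [FermatCharacter.append_embFirst, FermatCharacter.append_embFirst, ha, ← pow_add]
    have hα1 : α 1 = -α 0 := by
      have h := hα.2
      rw [Fin.sum_univ_two] at h
      exact eq_neg_of_add_eq_zero_right h
    rw [hα1, FermatCharacter.val_add_val_neg (hα.1 0)]
    exact mem_fermatGroup_iff.mp a.2 _
  rw [h1, one_mul]
  refine Finset.prod_congr rfl fun k _ ↦ ?_
  have : append α β ((finCongr (FermatCharacter.two_mul_add_two 0 s)).symm (Fin.natAdd (2 * 0 + 2) k)) = β k :=
    FermatCharacter.append_embSecond α β k
  rw [this]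
  rfl

set_option maxHeartbeats 400000 in
/-- **The conclusion of the cone-span leaf (III-l) from an incidence datum** (no automorphisms of `E`).
Let `m, s ≥ 1`, `S = X²ˢₘ`, `X = X^{2(0+s+1)}ₘ`, and `S ←π— E —φ→ X` a span of smooth projective
varieties (`dim E = 2s + 1`, `π` flat) with a closed-immersion section `σ` of `π`, such that:
(inc') for every `c ∈ μₘ^{2s+4}` with `c₀ ≠ c₁`, `g_c(φ P) = φ Q` only if `P = σ R` and
`Q = σ(g_{c|S} R)` for some `R`; (h1) `φ^*(φ_* 1) ≠ 0`. Then for all Hodge `α` of `X⁰ₘ`, `β ∈ 𝔅²ˢₘ`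
there is `w ∈ V(β)` with `π_{α∗β}(φ_*(π^* w)) ≠ 0`. Proof: module docstring (stabiliser average `x̄`,
clean base change for the squares `S → E ⇉ X`, uniform `K` by Lefschetz on `H²(X)`, self-term-free
criterion). [cite: Aoki1987, Thm. 1-4 (i) p. 388 and p. 386] [cite: Ran1980, §1 Prop. 1.14]
[cite: Fulton1998, Thm. 6.2 (a) and §19.2] [cite: Shioda1979HodgeFermat, Thm. I] -/
theorem coneSpan_represents_of_incidenceDatum [NeZero m] (hs : 1 ≤ s)
    {E : SchemeOver ℂ} (hE : IsSmoothProjective (2 * s + 1) E)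
    (hX : IsSmoothProjective (2 * (0 + s + 1)) (fermatHypersurface (2 * (0 + s + 1)) m))
    (π : E ⟶ fermatHypersurface (2 * s) m)
    (σ : fermatHypersurface (2 * s) m ⟶ E) (hσπ : σ ≫ π = 𝟙 _) [IsClosedImmersion σ.left]
    (φ : E ⟶ fermatHypersurface (2 * (0 + s + 1)) m)
    (hinc : ∀ c : fermatGroup (2 * (0 + s + 1)) m,
      (c : Fin (2 * (0 + s + 1) + 2) → ℂˣ) (embFirst 0 s 0) ≠
        (c : Fin (2 * (0 + s + 1) + 2) → ℂˣ) (embFirst 0 s 1) →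
      ∀ P Q : ComplexPoints E,
        AlgPoints.map (φ ≫ diagonalAut (fermatPolynomial ℂ (2 * (0 + s + 1)) m)
          (fermatGroup_le_diagonalStabilizer m c.2)) P = AlgPoints.map φ Q →
        ∃ R : ComplexPoints (fermatHypersurface (2 * s) m), AlgPoints.map σ R = P ∧
          AlgPoints.map (diagonalAut (fermatPolynomial ℂ (2 * s) m)
            (fermatGroup_le_diagonalStabilizer m (comp_embSecond_mem_fermatGroup c)) ≫ σ) R = Q)
    (h1 : complexBetti.map φ 2 (complexGysin complexOrientationFamily hE hX φ
      (show 0 + 2 * (2 * (0 + s + 1)) = 2 + 2 * (2 * s + 1) by omega)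
      (singularCohomology.one ℂ (ComplexPoints E))) ≠ 0)
    {α : Fin (2 * 0 + 2) → ZMod m} {β : Fin (2 * s + 2) → ZMod m}
    (hα : FermatCharacter.IsHodge α) (hβ : FermatCharacter.IsHodge β) :
    ∃ w ∈ fermatEigenspace m β (2 * s),
      fermatProjector m (append α β) (2 * (0 + s + 1))
        (complexGysin complexOrientationFamily hE hX φ
          (show 2 * s + 2 * (2 * (0 + s + 1)) = 2 * (0 + s + 1) + 2 * (2 * s + 1) by omega)
          (complexBetti.map π (2 * s) w)) ≠ 0 := by
  classical
  -- ## notation and basic facts (as in `coneSpan_represents_of_coneDatum`)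
  have hm : 1 ≤ m := NeZero.one_le
  have hμ : complexOrientationFamily.HasPoincareDuality := hasPoincareDuality_complexOrientationFamily
  have hS : IsSmoothProjective (2 * s) (fermatHypersurface (2 * s) m) :=
    isSmoothProjective_fermatHypersurface (by omega) hm
  have hdegσ : 2 * s + 2 * (2 * s + 1) = 2 * (0 + s + 1) + 2 * (2 * s) := by omega
  have hdegπ : 2 * (0 + s + 1) + 2 * (2 * s) = 2 * s + 2 * (2 * s + 1) := by omega
  have hdegφ : 2 * s + 2 * (2 * (0 + s + 1)) = 2 * (0 + s + 1) + 2 * (2 * s + 1) := by omega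
  have hdeg0 : 0 + 2 * (2 * (0 + s + 1)) = 2 + 2 * (2 * s + 1) := by omega
  set F := fermatPolynomial ℂ (2 * (0 + s + 1)) m with hFdef
  set FS := fermatPolynomial ℂ (2 * s) m with hFSdef
  -- ## a non-zero class `w ∈ V(β)`; `1_S ≠ 0`; `π_* σ_* = id`
  obtain ⟨w, hwV, hw0⟩ : ∃ w ∈ fermatEigenspace m β (2 * s), w ≠ 0 := by
    have h := Ran1980_fermatEigenspace_ne_bot m s β hs hβ.1.1 hβ.1.2
    rwa [ne_eq, ← ne_eq, Submodule.ne_bot_iff] at h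
  refine ⟨w, hwV, ?_⟩
  have h1S : singularCohomology.one ℂ (ComplexPoints (fermatHypersurface (2 * s) m)) ≠ 0 := by
    intro h0
    apply hw0
    rw [← cupProduct_one w, h0, map_zero]
  have hπσ : ∀ {a b : ℕ} (hab : a + 2 * (2 * s + 1) = b + 2 * (2 * s)) (hba : b + 2 * (2 * s) = a + 2 * (2 * s + 1))
      (y : complexBetti (fermatHypersurface (2 * s) m) a),
      complexGysin complexOrientationFamily hE hS π hba (complexGysin complexOrientationFamily hS hE σ hab y) = y := by
    intro a b hab hba y
    have hcomp := complexGysin_comp hμ hS hE hS σ π hab hba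
    rw [hσπ, complexGysin_id hμ hS] at hcomp
    have := congrArg (fun f ↦ f y) hcomp
    simpa using this.symm
  have hA : complexGysin complexOrientationFamily hS hE σ hdegσ w ≠ 0 := by
    intro h0
    apply hw0
    rw [← hπσ hdegσ hdegπ w, h0, map_zero]
  have hσ1 : complexGysin complexOrientationFamily hS hE σ
      (show 0 + 2 * (2 * s + 1) = 2 + 2 * (2 * s) by omega)
      (singularCohomology.one ℂ (ComplexPoints (fermatHypersurface (2 * s) m))) ≠ 0 := by
    intro h0
    apply h1S
    rw [← hπσ (show 0 + 2 * (2 * s + 1) = 2 + 2 * (2 * s) by omega)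
      (show 2 + 2 * (2 * s) = 0 + 2 * (2 * s + 1) by omega) (singularCohomology.one ℂ _), h0, map_zero]
  -- `σ^* π^* = id`
  have hσπ' : ∀ {a : ℕ} (y : complexBetti (fermatHypersurface (2 * s) m) a),
      complexBetti.map σ a (complexBetti.map π a y) = y := by
    intro a y
    rw [← CategoryTheory.comp_apply, ← complexBetti.map_comp, hσπ, complexBetti.map_id]
    rfl
  -- ## the vertex slots and the characters `δ = α ∗ β`, `δ' = 0 ∗ β`
  have h01 : (embFirst 0 s 0 : Fin (2 * (0 + s + 1) + 2)) ≠ embFirst 0 s 1 := fun h ↦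
    absurd ((embFirst 0 s).injective h) (by decide)
  have hδ0 : append α β (embFirst 0 s 0) ≠ 0 := by
    rw [FermatCharacter.append_embFirst]; exact hα.1.1 0
  have hsum : append α β (embFirst 0 s 0) + append α β (embFirst 0 s 1) = 0 := by
    rw [FermatCharacter.append_embFirst, FermatCharacter.append_embFirst]
    have h := hα.1.2
    rwa [Fin.sum_univ_two] at h
  have hδ'0 : append (0 : Fin (2 * 0 + 2) → ZMod m) β (embFirst 0 s 0) = 0 := by
    rw [FermatCharacter.append_embFirst]; rfl
  have hδ'1 : append (0 : Fin (2 * 0 + 2) → ZMod m) β (embFirst 0 s 1) = 0 := by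
    rw [FermatCharacter.append_embFirst]; rfl
  have hδ'j : ∀ j, j ≠ embFirst 0 s 0 → j ≠ embFirst 0 s 1 →
      append (0 : Fin (2 * 0 + 2) → ZMod m) β j = append α β j := by
    intro j hj0 hj1
    rcases FermatCharacter.embFirst_or_embSecond j with ⟨i, rfl⟩ | ⟨k, rfl⟩
    · exfalso
      fin_cases i
      · exact hj0 rfl
      · exact hj1 rfl
    · rw [FermatCharacter.append_embSecond, FermatCharacter.append_embSecond]
  have hδ'ne : append (0 : Fin (2 * 0 + 2) → ZMod m) β ≠ 0 := by
    intro h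
    have h' := congrFun h (embSecond 0 s 0)
    rw [FermatCharacter.append_embSecond, Pi.zero_apply] at h'
    exact hβ.1.1 0 h'
  -- ## Lefschetz: `(φ ≫ g_a)_* 1 = φ_* 1`
  have hsurj2 : Function.Surjective (complexBetti.map (SmoothHypersurface.hypersurfaceι F) 2) :=
    surjective_map_hypersurfaceι_of_lt (isSmoothHypersurface_fermatHypersurface (by omega) hm)
      (isHomogeneous_fermatPolynomial _ m) (irreducible_fermatPolynomial_of_isAlgClosed (by omega) hm)
      (by omega)
  have hone : ∀ a : fermatGroup (2 * (0 + s + 1)) m,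
      complexGysin complexOrientationFamily hE hX (φ ≫ diagonalAut F (fermatGroup_le_diagonalStabilizer m a.2))
          hdeg0 (singularCohomology.one ℂ (ComplexPoints E)) =
        complexGysin complexOrientationFamily hE hX φ hdeg0 (singularCohomology.one ℂ (ComplexPoints E)) := by
    intro a
    have ha' := fermatGroup_le_diagonalStabilizer m a.2
    rw [← complexBetti_map_complexGysin_of_comp_eq_id hX hX (diagonalAut F (inv_mem ha')) (diagonalAut F ha')
      (diagonalAut_comp_inv _ ha') (isBirational_diagonalAut_left _ ha') hE φ hdeg0]
    exact map_diagonalMap_eq_self_of_surjective (inv_mem ha') hsurj2 _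
  -- ## push-forward along an automorphism of `S`: `(g_b)_* w = χ_β(b)⁻¹ • w`, `(g_b)_* 1 = 1`
  have hgS : ∀ (b : Fin (2 * s + 2) → ℂˣ) (hb : b ∈ fermatGroup (2 * s) m),
      complexGysin complexOrientationFamily hS hS (diagonalAut FS (fermatGroup_le_diagonalStabilizer m hb))
          (rfl : 2 * s + 2 * (2 * s) = 2 * s + 2 * (2 * s)) w =
        ((fermatCharacter m β ⟨b, hb⟩ : ℂˣ) : ℂ)⁻¹ • w := by
    intro b hb
    have hb' := fermatGroup_le_diagonalStabilizer m hb
    rw [← complexBetti_map_eq_complexGysin_of_comp_eq_id hS hS (diagonalAut FS hb') (diagonalAut FS (inv_mem hb'))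
      (diagonalAut_comp_inv _ hb') (isBirational_diagonalAut_left _ hb')]
    have h := (mem_fermatEigenspace_iff.mp hwV) (⟨b, hb⟩ : fermatGroup (2 * s) m)⁻¹
    rw [map_inv, Units.val_inv_eq_inv_val] at h
    exact h
  have hgS1 : ∀ (b : Fin (2 * s + 2) → ℂˣ) (hb : b ∈ fermatGroup (2 * s) m),
      complexGysin complexOrientationFamily hS hS (diagonalAut FS (fermatGroup_le_diagonalStabilizer m hb))
          (rfl : 0 + 2 * (2 * s) = 0 + 2 * (2 * s)) (singularCohomology.one ℂ _) = singularCohomology.one ℂ _ :=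
    fun b hb ↦ complexGysin_complexOrientationFamily_one_of_isBirational hS hS _ (isBirational_diagonalAut_left _ _)
  -- ## the clean base change for the square `S —σ→ E —(φ ≫ g_c)→ X ←φ— E ←(g_{c|S} ≫ σ)— S`
  have hK : ∀ c : fermatGroup (2 * (0 + s + 1)) m,
      (c : Fin (2 * (0 + s + 1) + 2) → ℂˣ) (embFirst 0 s 0) ≠
        (c : Fin (2 * (0 + s + 1) + 2) → ℂˣ) (embFirst 0 s 1) →
      ∃ K : ℂ, K ≠ 0 ∧ ∀ ⦃a b : ℕ⦄ (hab : a + 2 * (2 * (0 + s + 1)) = b + 2 * (2 * s + 1))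
        (y : complexBetti E a),
        complexBetti.map φ b (complexGysin complexOrientationFamily hE hX
            (φ ≫ diagonalAut F (fermatGroup_le_diagonalStabilizer m c.2)) hab y) =
          K • complexGysin complexOrientationFamily hS hE
            (diagonalAut FS (fermatGroup_le_diagonalStabilizer m (comp_embSecond_mem_fermatGroup c)) ≫ σ)
            (show a + 2 * (2 * s + 1) = b + 2 * (2 * s) by omega) (complexBetti.map σ a y) := by
    intro c hc
    haveI : IsClosedImmersion (lift σ (diagonalAut FS
        (fermatGroup_le_diagonalStabilizer m (comp_embSecond_mem_fermatGroup c)) ≫ σ)).left :=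
      isClosedImmersion_lift_left_of_isSmoothProjective hE σ _
    exact complexGysin_cleanBaseChange_of_ne_zero complexOrientationFamily hE hX hE hS
      (φ ≫ diagonalAut F (fermatGroup_le_diagonalStabilizer m c.2)) φ σ
      (diagonalAut FS (fermatGroup_le_diagonalStabilizer m (comp_embSecond_mem_fermatGroup c)) ≫ σ)
      (by omega) (hinc c hc) hdeg0 (by rw [hone c]; exact h1)
  -- evaluated on `π^* w` and on `1`
  have hKw : ∀ {K : ℂ} (c : fermatGroup (2 * (0 + s + 1)) m),
      (∀ ⦃a b : ℕ⦄ (hab : a + 2 * (2 * (0 + s + 1)) = b + 2 * (2 * s + 1)) (y : complexBetti E a),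
        complexBetti.map φ b (complexGysin complexOrientationFamily hE hX
            (φ ≫ diagonalAut F (fermatGroup_le_diagonalStabilizer m c.2)) hab y) =
          K • complexGysin complexOrientationFamily hS hE
            (diagonalAut FS (fermatGroup_le_diagonalStabilizer m (comp_embSecond_mem_fermatGroup c)) ≫ σ)
            (show a + 2 * (2 * s + 1) = b + 2 * (2 * s) by omega) (complexBetti.map σ a y)) →
      complexBetti.map φ (2 * (0 + s + 1)) (complexGysin complexOrientationFamily hE hX
          (φ ≫ diagonalAut F (fermatGroup_le_diagonalStabilizer m c.2)) hdegφ (complexBetti.map π (2 * s) w)) =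
        (K * ((fermatCharacter m (append (0 : Fin (2 * 0 + 2) → ZMod m) β) c : ℂˣ) : ℂ)⁻¹) •
          complexGysin complexOrientationFamily hS hE σ hdegσ w ∧
      complexBetti.map φ 2 (complexGysin complexOrientationFamily hE hX φ hdeg0
          (singularCohomology.one ℂ (ComplexPoints E))) =
        K • complexGysin complexOrientationFamily hS hE σ
          (show 0 + 2 * (2 * s + 1) = 2 + 2 * (2 * s) by omega)
          (singularCohomology.one ℂ (ComplexPoints (fermatHypersurface (2 * s) m))) := by
    intro K c hKc
    constructor
    · rw [hKc hdegφ, hσπ', complexGysin_comp hμ hS hS hE _ σ (rfl : 2 * s + 2 * (2 * s) = 2 * s + 2 * (2 * s))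
        hdegσ, LinearMap.comp_apply, hgS _ (comp_embSecond_mem_fermatGroup c), map_smul, smul_smul,
        fermatCharacter_append_zero]
    · have h := hKc hdeg0 (singularCohomology.one ℂ (ComplexPoints E))
      rw [hone c, show complexBetti.map σ 0 (singularCohomology.one ℂ (ComplexPoints E)) =
          singularCohomology.one ℂ (ComplexPoints (fermatHypersurface (2 * s) m)) from singularCohomology.map_one _,
        complexGysin_comp hμ hS hS hE _ σ (rfl : 0 + 2 * (2 * s) = 0 + 2 * (2 * s))
          (show 0 + 2 * (2 * s + 1) = 2 + 2 * (2 * s) by omega), LinearMap.comp_apply,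
        hgS1 _ (comp_embSecond_mem_fermatGroup c)] at h
      exact h
  -- ## a reference move `q₀ = (1, ζ, 1, …, 1)` and the common scalar `K₀`
  have hζ := Complex.isPrimitiveRoot_exp m (NeZero.ne m)
  set ζ : rootsOfUnity m ℂ := hζ.toRootsOfUnity with hζdef
  have hζu : IsPrimitiveRoot (ζ : ℂˣ) m :=
    IsPrimitiveRoot.coe_units_iff.mp (by simpa [hζdef] using hζ)
  have hζ1 : ((ζ : ℂˣ)) ≠ 1 := by
    intro h1'
    rw [h1'] at hζu
    have hm1 : m = 1 := hζu.unique IsPrimitiveRoot.one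
    haveI : Subsingleton (ZMod m) := (ZMod.subsingleton_iff).mpr hm1
    exact hδ0 (Subsingleton.elim _ _)
  have hq₀ : ((fermatGroupSingle (embFirst 0 s 1) ζ : fermatGroup (2 * (0 + s + 1)) m) :
      Fin (2 * (0 + s + 1) + 2) → ℂˣ) (embFirst 0 s 0) ≠
      ((fermatGroupSingle (embFirst 0 s 1) ζ : fermatGroup (2 * (0 + s + 1)) m) :
      Fin (2 * (0 + s + 1) + 2) → ℂˣ) (embFirst 0 s 1) := by
    rw [fermatGroupSingle_apply_of_ne' _ _ h01 ζ, fermatGroupSingle_apply_self _ ζ]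
    exact hζ1.symm
  obtain ⟨K₀, hK₀, hK₀eq⟩ := hK _ hq₀
  have hK₀one := (hKw _ hK₀eq).2
  have hKeq : ∀ {K : ℂ} (c : fermatGroup (2 * (0 + s + 1)) m),
      (∀ ⦃a b : ℕ⦄ (hab : a + 2 * (2 * (0 + s + 1)) = b + 2 * (2 * s + 1)) (y : complexBetti E a),
        complexBetti.map φ b (complexGysin complexOrientationFamily hE hX
            (φ ≫ diagonalAut F (fermatGroup_le_diagonalStabilizer m c.2)) hab y) =
          K • complexGysin complexOrientationFamily hS hE
            (diagonalAut FS (fermatGroup_le_diagonalStabilizer m (comp_embSecond_mem_fermatGroup c)) ≫ σ)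
            (show a + 2 * (2 * s + 1) = b + 2 * (2 * s) by omega) (complexBetti.map σ a y)) → K = K₀ := by
    intro K c hKc
    have h := (hKw c hKc).2.symm.trans hK₀one
    rw [← sub_eq_zero, ← sub_smul, smul_eq_zero] at h
    exact sub_eq_zero.mp (h.resolve_right hσ1)
  -- ## `φ^*(g_c^* x) = K₀ χ_{0∗β}(c) • σ_* w` for EVERY `c` off the stabiliser
  have hoffx : ∀ c : fermatGroup (2 * (0 + s + 1)) m,
      (c : Fin (2 * (0 + s + 1) + 2) → ℂˣ) (embFirst 0 s 0) ≠
        (c : Fin (2 * (0 + s + 1) + 2) → ℂˣ) (embFirst 0 s 1) →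
      complexBetti.map φ (2 * (0 + s + 1))
          (singularCohomology.map ℂ ℂ (diagonalMap F (fermatGroup_le_diagonalStabilizer m c.2)) (2 * (0 + s + 1))
            (complexGysin complexOrientationFamily hE hX φ hdegφ (complexBetti.map π (2 * s) w))) =
        (K₀ * ((fermatCharacter m (append (0 : Fin (2 * 0 + 2) → ZMod m) β) c : ℂˣ) : ℂ)) •
          complexGysin complexOrientationFamily hS hE σ hdegσ w := by
    intro c hc
    rw [map_diagonalMap_complexGysin _ hX (fermatGroup_le_diagonalStabilizer m c.2) hE φ hdegφ]
    -- `c⁻¹` is off the stabiliser too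
    have hci : ((c⁻¹ : fermatGroup (2 * (0 + s + 1)) m) : Fin (2 * (0 + s + 1) + 2) → ℂˣ) (embFirst 0 s 0) ≠
        ((c⁻¹ : fermatGroup (2 * (0 + s + 1)) m) : Fin (2 * (0 + s + 1) + 2) → ℂˣ) (embFirst 0 s 1) := by
      change ((c : Fin (2 * (0 + s + 1) + 2) → ℂˣ) (embFirst 0 s 0))⁻¹ ≠
        ((c : Fin (2 * (0 + s + 1) + 2) → ℂˣ) (embFirst 0 s 1))⁻¹
      exact fun h ↦ hc (inv_injective h)
    obtain ⟨K, -, hKc⟩ := hK (c⁻¹) hci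
    have hKK₀ : K = K₀ := hKeq (c⁻¹) hKc
    have h := (hKw (c⁻¹) hKc).1
    rw [hKK₀, map_inv, Units.val_inv_eq_inv_val, inv_inv] at h
    exact h
  -- ## the stabiliser average `x̄ = N⁻¹ Σ_{a₀ = a₁} χ_{0∗β}(a)⁻¹ g_a^* x`
  let P : fermatGroup (2 * (0 + s + 1)) m → Prop := fun a ↦
    (a : Fin (2 * (0 + s + 1) + 2) → ℂˣ) (embFirst 0 s 0) = (a : Fin (2 * (0 + s + 1) + 2) → ℂˣ) (embFirst 0 s 1)
  set T : Finset (fermatGroup (2 * (0 + s + 1)) m) := Finset.univ.filter (fun a ↦ P a) with hTdef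
  set N : ℕ := T.card with hNdef
  have hNpos : (N : ℂ) ≠ 0 := by
    rw [Nat.cast_ne_zero, hNdef, ← Nat.pos_iff_ne_zero, Finset.card_pos]
    exact ⟨1, Finset.mem_filter.mpr ⟨Finset.mem_univ _, rfl⟩⟩
  set x := complexGysin complexOrientationFamily hE hX φ hdegφ (complexBetti.map π (2 * s) w) with hxdef
  set xbar := (N : ℂ)⁻¹ • ∑ a ∈ T, ((fermatCharacter m (append (0 : Fin (2 * 0 + 2) → ZMod m) β) a : ℂˣ) : ℂ)⁻¹ •
    singularCohomology.map ℂ ℂ (diagonalMap F (fermatGroup_le_diagonalStabilizer m a.2)) (2 * (0 + s + 1)) x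
    with hxbardef
  -- `g_b^* g_a^* = g_{ab}^*`
  have hgg : ∀ (a b : fermatGroup (2 * (0 + s + 1)) m) (y : complexBetti (fermatHypersurface (2 * (0 + s + 1)) m) (2 * (0 + s + 1))),
      singularCohomology.map ℂ ℂ (diagonalMap F (fermatGroup_le_diagonalStabilizer m b.2)) (2 * (0 + s + 1))
        (singularCohomology.map ℂ ℂ (diagonalMap F (fermatGroup_le_diagonalStabilizer m a.2)) (2 * (0 + s + 1)) y) =
      singularCohomology.map ℂ ℂ (diagonalMap F (fermatGroup_le_diagonalStabilizer m (a * b).2)) (2 * (0 + s + 1)) y := by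
    intro a b y
    rw [singularCohomology.map_map, ← diagonalMap_mul]
  -- ## `x̄` is an eigenvector of the stabiliser
  have hstab : ∀ b : fermatGroup (2 * (0 + s + 1)) m, P b →
      singularCohomology.map ℂ ℂ (diagonalMap F (fermatGroup_le_diagonalStabilizer m b.2)) (2 * (0 + s + 1)) xbar =
        ((fermatCharacter m (append (0 : Fin (2 * 0 + 2) → ZMod m) β) b : ℂˣ) : ℂ) • xbar := by
    intro b hb
    have key : ∑ a ∈ T, ((fermatCharacter m (append (0 : Fin (2 * 0 + 2) → ZMod m) β) a : ℂˣ) : ℂ)⁻¹ •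
        singularCohomology.map ℂ ℂ (diagonalMap F (fermatGroup_le_diagonalStabilizer m b.2)) (2 * (0 + s + 1))
          (singularCohomology.map ℂ ℂ (diagonalMap F (fermatGroup_le_diagonalStabilizer m a.2)) (2 * (0 + s + 1)) x) =
        ((fermatCharacter m (append (0 : Fin (2 * 0 + 2) → ZMod m) β) b : ℂˣ) : ℂ) •
          ∑ a ∈ T, ((fermatCharacter m (append (0 : Fin (2 * 0 + 2) → ZMod m) β) a : ℂˣ) : ℂ)⁻¹ •
            singularCohomology.map ℂ ℂ (diagonalMap F (fermatGroup_le_diagonalStabilizer m a.2)) (2 * (0 + s + 1)) x := by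
      rw [Finset.smul_sum]
      simp_rw [hgg]
      -- reindex `a ↦ a * b`
      refine Finset.sum_equiv (Equiv.mulRight b) (fun a ↦ ?_) (fun a _ ↦ ?_)
      · simp only [hTdef, Finset.mem_filter, Finset.mem_univ, true_and, Equiv.coe_mulRight]
        change _ ↔ (a : Fin (2 * (0 + s + 1) + 2) → ℂˣ) (embFirst 0 s 0) * (b : _ → ℂˣ) (embFirst 0 s 0) =
          (a : Fin (2 * (0 + s + 1) + 2) → ℂˣ) (embFirst 0 s 1) * (b : _ → ℂˣ) (embFirst 0 s 1)
        rw [hb]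
        exact ⟨fun h ↦ by rw [h], fun h ↦ mul_right_cancel h⟩
      · rw [Equiv.coe_mulRight, smul_smul, map_mul, Units.val_mul, mul_inv,
          mul_comm (((fermatCharacter m (append (0 : Fin (2 * 0 + 2) → ZMod m) β) a : ℂˣ) : ℂ))⁻¹, ← mul_assoc,
          mul_inv_cancel₀ (Units.ne_zero _), one_mul]
    rw [hxbardef, map_smul, map_sum]
    simp_rw [map_smul]
    rw [key, smul_comm]
  -- ## off the stabiliser: `φ^*(g_b^* x̄) = χ(b) K₀ • σ_* w`
  have hoff : ∀ b : fermatGroup (2 * (0 + s + 1)) m, ¬ P b →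
      (complexBetti.map φ (2 * (0 + s + 1))).hom
        (singularCohomology.map ℂ ℂ (diagonalMap F (fermatGroup_le_diagonalStabilizer m b.2)) (2 * (0 + s + 1)) xbar) =
        (((fermatCharacter m (append (0 : Fin (2 * 0 + 2) → ZMod m) β) b : ℂˣ) : ℂ) * K₀) •
          complexGysin complexOrientationFamily hS hE σ hdegσ w := by
    intro b hb
    change complexBetti.map φ (2 * (0 + s + 1)) _ = _
    rw [hxbardef, map_smul, map_sum, map_smul, map_sum]
    simp_rw [map_smul, hgg]
    have hterm : ∀ a ∈ T, ((fermatCharacter m (append (0 : Fin (2 * 0 + 2) → ZMod m) β) a : ℂˣ) : ℂ)⁻¹ •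
        complexBetti.map φ (2 * (0 + s + 1))
          (singularCohomology.map ℂ ℂ (diagonalMap F (fermatGroup_le_diagonalStabilizer m (a * b).2))
            (2 * (0 + s + 1)) x) =
        (K₀ * ((fermatCharacter m (append (0 : Fin (2 * 0 + 2) → ZMod m) β) b : ℂˣ) : ℂ)) •
          complexGysin complexOrientationFamily hS hE σ hdegσ w := by
      intro a ha
      have haP : P a := (Finset.mem_filter.mp ha).2
      have hab : ¬ P (a * b) := by
        intro h
        apply hb
        change (a : Fin (2 * (0 + s + 1) + 2) → ℂˣ) (embFirst 0 s 0) * (b : _ → ℂˣ) (embFirst 0 s 0) =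
          (a : Fin (2 * (0 + s + 1) + 2) → ℂˣ) (embFirst 0 s 1) * (b : _ → ℂˣ) (embFirst 0 s 1) at h
        rw [haP] at h
        exact mul_left_cancel h
      rw [hxdef, hoffx (a * b) hab, smul_smul, map_mul, Units.val_mul]
      congr 1
      field_simp
    rw [Finset.sum_congr rfl hterm, Finset.sum_const, ← hNdef, ← Nat.cast_smul_eq_nsmul ℂ, smul_smul,
      inv_mul_cancel₀ hNpos, one_smul]
    congr 1
    exact mul_comm _ _
  -- ## the criterion without self-term, for `x̄`
  have hbar := fermatProjector_ne_zero_of_offStabilizer_restrictions (r := 0 + s + 1) (by omega)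
    (append α β) (append (0 : Fin (2 * 0 + 2) → ZMod m) β) h01 hδ0 hsum hδ'0 hδ'1 hδ'j hδ'ne xbar
    (complexBetti.map φ (2 * (0 + s + 1))).hom hA hK₀ hstab hoff
  -- ## `π_{α∗β} x̄ = π_{α∗β} x`
  have hproj : fermatProjector m (append α β) (2 * (0 + s + 1)) xbar =
      fermatProjector m (append α β) (2 * (0 + s + 1)) x := by
    rw [hxbardef, map_smul, map_sum]
    have hterm : ∀ a ∈ T, fermatProjector m (append α β) (2 * (0 + s + 1))
        (((fermatCharacter m (append (0 : Fin (2 * 0 + 2) → ZMod m) β) a : ℂˣ) : ℂ)⁻¹ •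
          singularCohomology.map ℂ ℂ (diagonalMap F (fermatGroup_le_diagonalStabilizer m a.2)) (2 * (0 + s + 1)) x) =
        fermatProjector m (append α β) (2 * (0 + s + 1)) x := by
      intro a ha
      have haP : P a := (Finset.mem_filter.mp ha).2
      rw [map_smul, fermatProjector_map_diagonalMap, smul_smul,
        fermatCharacter_append_eq_of_apply_eq hα.1 β a haP, inv_mul_cancel₀ (Units.ne_zero _), one_smul]
    rw [Finset.sum_congr rfl hterm, Finset.sum_const, ← hNdef, ← Nat.cast_smul_eq_nsmul ℂ, smul_smul,
      inv_mul_cancel₀ hNpos, one_smul]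
  rw [← hproj]
  exact hbar

/-- **The cone-span leaf (III-l) from incidence data for all `m, s ≥ 1`** (no automorphisms of the total
space): if for every `m ≥ 1`, `s ≥ 1` there is a span `X²ˢₘ ←π— E —φ→ X^{2(0+s+1)}ₘ` (`E` smooth
projective of dimension `2s+1`, `π` flat) with a closed-immersion section `σ` satisfying (inc') and
(h1) of `coneSpan_represents_of_incidenceDatum`, then `Shioda1979_coneSpan_represents_left` holds.
Residual obligation of the leaf on this road: exactly such incidence data (in print: the cone
`{x₁ = ε x₀} ∩ X` blown up at its vertex, its base section and blow-down).
[cite: Aoki1987, Thm. 1-4 (i) p. 388 and p. 386] [cite: daSilva2021HodgeFermat, Thm. 2.2 (b)]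
[cite: Shioda1979HodgeFermat, Thm. I] -/
theorem Shioda1979_coneSpan_represents_left_of_incidenceData
    (hdata : ∀ (m s : ℕ) [NeZero m], 1 ≤ s →
      ∃ (E : SchemeOver ℂ) (hE : IsSmoothProjective (2 * s + 1) E)
        (π : E ⟶ fermatHypersurface (2 * s) m) (_ : Flat π.left)
        (σ : fermatHypersurface (2 * s) m ⟶ E) (_ : σ ≫ π = 𝟙 _) (_ : IsClosedImmersion σ.left)
        (φ : E ⟶ fermatHypersurface (2 * (0 + s + 1)) m),
        (∀ c : fermatGroup (2 * (0 + s + 1)) m,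
          (c : Fin (2 * (0 + s + 1) + 2) → ℂˣ) (embFirst 0 s 0) ≠
            (c : Fin (2 * (0 + s + 1) + 2) → ℂˣ) (embFirst 0 s 1) →
          ∀ P Q : ComplexPoints E,
            AlgPoints.map (φ ≫ diagonalAut (fermatPolynomial ℂ (2 * (0 + s + 1)) m)
              (fermatGroup_le_diagonalStabilizer m c.2)) P = AlgPoints.map φ Q →
            ∃ R : ComplexPoints (fermatHypersurface (2 * s) m), AlgPoints.map σ R = P ∧
              AlgPoints.map (diagonalAut (fermatPolynomial ℂ (2 * s) m)
                (fermatGroup_le_diagonalStabilizer m (comp_embSecond_mem_fermatGroup c)) ≫ σ) R = Q) ∧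
        complexBetti.map φ 2 (complexGysin complexOrientationFamily hE
          (isSmoothProjective_fermatHypersurface (n := 2 * (0 + s + 1)) (by omega) NeZero.one_le) φ
          (show 0 + 2 * (2 * (0 + s + 1)) = 2 + 2 * (2 * s + 1) by omega)
          (singularCohomology.one ℂ (ComplexPoints E))) ≠ 0) :
    Shioda1979_coneSpan_represents_left := by
  intro m s _ α β hs hα hβ
  obtain ⟨E, hE, π, hπ, σ, hσπ, hσ, φ, hinc, h1⟩ := hdata m s hs
  haveI := hπ
  haveI := hσ
  have hX : IsSmoothProjective (2 * (0 + s + 1)) (fermatHypersurface (2 * (0 + s + 1)) m) :=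
    isSmoothProjective_fermatHypersurface (by omega) NeZero.one_le
  obtain ⟨w, hw, hne⟩ := coneSpan_represents_of_incidenceDatum hs hE hX π σ hσπ φ hinc h1 hα hβ
  exact ⟨complexOrientationFamily, 2 * s + 1, E, hE, hX, π, hπ, φ, rfl, w, hw, hne⟩

end Literature.AlgebraicGeometry.HodgeTheory

end
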